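import Summits.AtomisticToContinuum.HydrodynamicLimit.Theorems.AntiMazurCoboundariesInfluenceLocalityObjects
import Summits.AtomisticToContinuum.HydrodynamicLimit.Theorems.AntiMazurCoboundariesInfluenceLocalityForecastWorldsGood
import Summits.AtomisticToContinuum.HydrodynamicLimit.Theorems.AntiMazurCoboundariesInfluenceLocalityEnergyDomination
import Summits.AtomisticToContinuum.HydrodynamicLimit.Theorems.AntiMazurCoboundariesInfluenceLocalityAnchoredCovering
import Summits.AtomisticToContinuum.HydrodynamicLimit.Theorems.AntiMazurCoboundariesInfluenceLocalityTrueCapsExist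
import HarnessLib

/-!
# Line `true-anchored-infection` for crux `InfluenceLocality` (stmt-AtomisticToContinuum-13916) — SKELETON

Lead-owned skeleton (prover-line-stmt-AtomisticToContinuum-13916-0) of the registered line; the objects,
events, cap schedules and the seven stub STATEMENTS live in the landed objects module
`Theorems/AntiMazurCoboundariesInfluenceLocalityObjects.lean` (namespace
`Summit.AtomisticToContinuum.HydrodynamicLimit.Theorems.TrueAnchoredInfection`, shared with the stub
helper files `Theorems/AntiMazurCoboundariesInfluenceLocality<Stub>.lean`, one per registered stub,
`--supports stmt-AtomisticToContinuum-13916`). This file keeps ONLY the seven registered `stub_*`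
theorems (the only `sorry`s; each is deleted here when its helper file lands and is imported instead)
and the sorry-free glue: measurability of the chain count, the counting lemma, the pressure
inequality, the cap arithmetic, the composition `eventually_of_stubs : stubs → InfluenceLocalityEventually`
and THE SKELETON THEOREM `InfluenceLocality_of`, which concludes the route decl
`AntiMazurCoboundaries.InfluenceLocality` BY NAME.

THE LEVER, THE COMPOSITION and THE HONEST STATUS OF THE STUBS: see the module docstring of the objects
file and the line card `Cruxes/InfluenceLocality/Lines/true-anchored-infection.md`. In one sentence:
outside two genuine-cap "hot" events (a `u(R)`-fast true particle in the halo of `i`; a forecast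
backward cluster of more than `M(R)` members) badness of `i` at range `R` forces a tight anchored
causal chain of `K ≍ R/σ` TRUE particles ending at `i` (stubs 1–3, with energy domination making
forecast speeds `≤ u√M`), whose pressure is stub 6; the hot-bad residual is stub 7 (contested: the
panel's blast/steered-cascade family gives it a cost per particle bounded in `R`, so it — and with it
the typed `∀ lam` crux — is expected to fail above `lam_c(T,σ) ≈ λ_mf²/(θT²)`; the re-typing target
`FirstMomentLocality` is served by stubs 1–6 verbatim).

Disproof.lean (cdisprove cycle 1 v4) honoured: `δ > 0` and `lam`-before-`R` kept; eventual-in-`R` shape;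
no `_false_without_` theorem / `-- Targets` exist for this crux yet (2026-08-16T05:40Z).
-/

namespace Summit.AtomisticToContinuum.HydrodynamicLimit.Theorems.TrueAnchoredInfection

open MeasureTheory Set
open scoped Classical ENNReal
open Literature.Analysis.FluidPDE Literature.MathematicalPhysics.KineticTheory
open Summit.AtomisticToContinuum.HydrodynamicLimit.Theses.AntiMazurCoboundaries (InfluenceLocality)

noncomputable section

/-! ## Registered stubs -/

-- stub_forecastWorldsGood : ForecastWorldsGood — LANDED (p91209), imported above.

-- stub_energyDomination : EnergyDomination — LANDED (p91351), imported above.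

-- stub_anchoredCovering : AnchoredCovering — LANDED (p97019), imported above.

-- stub_trueCapsExist : TrueCapsExist — LANDED (p95475), imported above.

/-- STUB 5 (open; worker wave 1: `stub-blocked: size`, prelim landed as
`…ForecastCapsExistPrelim.lean` — remaining goal `ForecastClusterCardTail`, the `G_free` cardinality
tail of the released cluster, open at fixed density beyond one Lanford time). -/
theorem stub_forecastCapsExist : ForecastCapsExist := by
  sorry

/-- STUB 6 — REFUTED AS STATED by worker wave 1 (`stub-false: slack concentration`): with grid
times `q = (0,…,0,1)` a STATIC near-contact necklace of `K−1` links at time `0` plus ONE last link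
carrying the whole slack `w·Tℓ` is a tight anchored `w`-chain (`isTightChain_of_staticNecklace`,
prelim `…TightChainPressureNecklace.lean`), so all `≍ (wT)³` particles within `wTℓ` of a necklace end
are chain ends; tiling 𝕋³ by cubes of side `wTℓ/4` gives `chainCount = N+1` at `G_N`-cost
`≈ 64·K·log(K/σ³)/(wT)³·(N+1) = o_w(1)·(N+1)` for `K = ⌈C(1+w)⌉`, hence the bound fails for every
`lam > δ` at large `w`; a straight static filament kills every polynomial threshold `K ≥ C·poly(w)`
and the line's own schedule (`w² = θR`, `K ≍ R/σ`). Kept as a `sorry` only to keep the registered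
skeleton elaborating; see `Lines/true-anchored-infection.dead.md`. -/
theorem stub_tightChainPressure : TightChainPressure := by
  sorry

/-- STUB 7 (lead; the hot sector of the typed `∀ lam` crux, implied by the eventual crux —
`hotResidual_of_eventually` — and believed FALSE above `lam_c(T,σ,θ) ≈ λ_mf²/(θT²)` by the blast /
steered-cascade family with linear yield, kit j009553; see the dead-line note). -/
theorem stub_hotResidualPressure : HotResidualPressure := by
  sorry

/-! ## Sorry-free glue: measurability of the chain count, counting, composition -/

/-- The tight-chain event is measurable (countable union over particle sequences and rational
grid times of finite intersections of preimages under the measurable time-`t` maps). -/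
theorem measurableSet_isTightChain (σ T : ℝ) (N : ℕ) (Φ : Flow σ N) (w : ℝ) (K : ℕ)
    (i : Fin (N + 1)) : MeasurableSet {z : Phase N | IsTightChain σ T N Φ w K z i} := by
  have hdist : ∀ (t₁ t₂ : ℝ) (a b : Fin (N + 1)) (c : ℝ), MeasurableSet {z : Phase N |
      Torus.euclidDist (Φ.flow t₁ z a).1 (Φ.flow t₂ z b).1 ≤ c} := by
    intro t₁ t₂ a b c
    have h1 : Measurable fun z : Phase N => (Φ.flow t₁ z a).1 :=
      ((measurable_pi_apply a).comp (Φ.measurable_flow t₁)).fst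
    have h2 : Measurable fun z : Phase N => (Φ.flow t₂ z b).1 :=
      ((measurable_pi_apply b).comp (Φ.measurable_flow t₂)).fst
    have h : Measurable fun z : Phase N =>
        Torus.euclidDist (Φ.flow t₁ z a).1 (Φ.flow t₂ z b).1 :=
      (Torus.measurable_reprSym.comp (h1.sub h2)).norm
    exact measurableSet_le h measurable_const
  have heq : {z : Phase N | IsTightChain σ T N Φ w K z i} =
      ⋃ (j : Fin (K + 1) → Fin (N + 1)), ⋃ (q : Fin (K + 1) → ℚ),
        {_z : Phase N | Function.Injective j ∧ j (Fin.last K) = i ∧ Monotone q ∧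
            (∀ m, 0 ≤ q m ∧ q m ≤ 1)} ∩
        ⋂ m : Fin K, {z : Phase N |
          Torus.euclidDist (Φ.flow (T * ell N * q m.succ) z (j m.succ)).1
              (Φ.flow (T * ell N * q m.castSucc) z (j m.castSucc)).1
            ≤ hsDiameter σ N * (1 + 1 / (K + 1)) + w * (T * ell N * (q m.succ - q m.castSucc))} := by
    ext z
    simp only [IsTightChain, Set.mem_setOf_eq, Set.mem_iUnion, Set.mem_inter_iff, Set.mem_iInter]
    constructor
    · rintro ⟨j, q, h1, h2, h3, h4, h5⟩
      exact ⟨j, q, ⟨h1, h2, h3, h4⟩, h5⟩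
    · rintro ⟨j, q, ⟨h1, h2, h3, h4⟩, h5⟩
      exact ⟨j, q, h1, h2, h3, h4, h5⟩
  rw [heq]
  refine MeasurableSet.iUnion fun j => MeasurableSet.iUnion fun q => ?_
  exact (MeasurableSet.const _).inter (MeasurableSet.iInter fun m => hdist _ _ _ _ _)

/-- Measurability of the exponential of the chain count (needed to split one lower integral). -/
theorem measurable_exp_chainCount (σ T : ℝ) (N : ℕ) (Φ : Flow σ N) (w : ℝ) (K : ℕ) (c : ℝ) :
    Measurable fun z : Phase N =>
      ENNReal.ofReal (Real.exp (c * (chainCount σ T N Φ w K z : ℝ))) := by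
  have hcount : Measurable fun z : Phase N => (chainCount σ T N Φ w K z : ℝ) := by
    have heq : (fun z : Phase N => (chainCount σ T N Φ w K z : ℝ)) =
        fun z => ∑ i : Fin (N + 1), (if IsTightChain σ T N Φ w K z i then (1 : ℝ) else 0) := by
      funext z
      rw [chainCount, Finset.card_filter]
      push_cast
      rfl
    rw [heq]
    refine Finset.measurable_sum _ fun i _ => ?_
    exact Measurable.ite (measurableSet_isTightChain σ T N Φ w K i) measurable_const
      measurable_const
  exact ((measurable_const.mul hcount).exp).ennreal_ofReal

/-- COUNTING: if every bad particle is hot-bad or a chain endpoint, `#bad ≤ #hotBad + #chainEnd`. -/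
theorem badCount_le_of_cover {σ T R : ℝ} {N : ℕ} {Φ : Flow σ N} {Ψ : ClusterFlows σ N}
    {u₀ : V3} {u D w : ℝ} {M K : ℕ} {z : Phase N}
    (h : ∀ i, IsBad σ T R N Φ Ψ z i →
      (IsBad σ T R N Φ Ψ z i ∧ (IsHot σ T N Φ u₀ u (R + D) z i ∨ IsGathering σ T R N Ψ M z i)) ∨
        IsTightChain σ T N Φ w K z i) :
    badCount σ T R N Φ Ψ z ≤ hotBadCount σ T R N Φ Ψ u₀ u D M z + chainCount σ T N Φ w K z := by
  rw [badCount_eq, hotBadCount, chainCount]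
  calc (Finset.univ.filter fun i => IsBad σ T R N Φ Ψ z i).card
      ≤ ((Finset.univ.filter fun i : Fin (N + 1) => IsBad σ T R N Φ Ψ z i ∧
            (IsHot σ T N Φ u₀ u (R + D) z i ∨ IsGathering σ T R N Ψ M z i)) ∪
          (Finset.univ.filter fun i : Fin (N + 1) => IsTightChain σ T N Φ w K z i)).card := by
        refine Finset.card_le_card fun i hi => ?_
        rw [Finset.mem_filter] at hi
        rcases h i hi.2 with h' | h'
        · exact Finset.mem_union_left _ (Finset.mem_filter.2 ⟨Finset.mem_univ _, h'⟩)
        · exact Finset.mem_union_right _ (Finset.mem_filter.2 ⟨Finset.mem_univ _, h'⟩)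
    _ ≤ _ := Finset.card_union_le _ _

/-- The elementary pressure inequality `e^{c(x+y)} ≤ ½ (e^{2cx} + e^{2cy})`, in `ℝ≥0∞`. -/
theorem ofReal_exp_mul_add_le (c x y : ℝ) :
    ENNReal.ofReal (Real.exp (c * (x + y))) ≤
      ENNReal.ofReal (Real.exp (2 * c * x)) * 2⁻¹ + ENNReal.ofReal (Real.exp (2 * c * y)) * 2⁻¹ := by
  have key : Real.exp (c * (x + y)) ≤ Real.exp (2 * c * x) / 2 + Real.exp (2 * c * y) / 2 := by
    have h1 : Real.exp (c * (x + y)) = Real.exp (c * x) * Real.exp (c * y) := by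
      rw [mul_add, Real.exp_add]
    have h2 : Real.exp (2 * c * x) = Real.exp (c * x) ^ 2 := by
      rw [sq, ← Real.exp_add]; ring_nf
    have h3 : Real.exp (2 * c * y) = Real.exp (c * y) ^ 2 := by
      rw [sq, ← Real.exp_add]; ring_nf
    rw [h1, h2, h3]
    nlinarith [sq_nonneg (Real.exp (c * x) - Real.exp (c * y))]
  calc ENNReal.ofReal (Real.exp (c * (x + y)))
      ≤ ENNReal.ofReal (Real.exp (2 * c * x) / 2 + Real.exp (2 * c * y) / 2) :=
        ENNReal.ofReal_le_ofReal key
    _ = ENNReal.ofReal (Real.exp (2 * c * x) / 2) + ENNReal.ofReal (Real.exp (2 * c * y) / 2) :=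
        ENNReal.ofReal_add (by positivity) (by positivity)
    _ = _ := by
        rw [ENNReal.ofReal_div_of_pos two_pos, ENNReal.ofReal_div_of_pos two_pos,
          ENNReal.ofReal_ofNat, div_eq_mul_inv, div_eq_mul_inv]

/-- CAP ARITHMETIC: for `(α + β + 1)² ≤ R` (with `α, β ≥ 0`) one has `α √R + β ≤ R`. -/
theorem sqrt_budget {α β R : ℝ} (hα : 0 ≤ α) (hβ : 0 ≤ β) (hR : (α + β + 1) ^ 2 ≤ R) :
    α * Real.sqrt R + β ≤ R := by
  have hR0 : 0 ≤ R := le_trans (sq_nonneg _) hR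
  have hs : α + β + 1 ≤ Real.sqrt R := by
    rw [← Real.sqrt_sq (by positivity : 0 ≤ α + β + 1)]
    exact Real.sqrt_le_sqrt hR
  have hs1 : 1 ≤ Real.sqrt R := by linarith
  have hRR : Real.sqrt R * Real.sqrt R = R := Real.mul_self_sqrt hR0
  nlinarith [mul_le_mul_of_nonneg_right hs (Real.sqrt_nonneg R)]

/-- **COMPOSITION.** The seven stub STATEMENTS imply the EVENTUAL form of the crux (every
`R ≥ R₀`; the crux by name is `InfluenceLocality_of` below). Order of choices: `σ₀ := min`;
given `σ, T, lam, δ`: the affine constant `C` of the chain pressure at rate `2 lam`; the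
genuine admissible caps `u(·), M(·)` of stubs 4–5; `R₀'` of the hot residual at rate `2 lam`
for these caps; `R₀ := max(R₀', R₁, Rₐ, R_b)` with
`R₁ = ((Cσ + 2T)(√θ + ‖u₀‖) + (C + 3)σ + 1)²`; relative forecast cap `w := u(R)√M(R) ≤ √(θR)`,
absolute chain speed `w + ‖u₀‖`, `K := ⌈C(1 + w + ‖u₀‖)⌉`, halo `D := (u(R) + ‖u₀‖)T + 2σ`;
then a.e. `#bad ≤ #hotBad + #chainEnd` (covering + energy domination: a forecast particle of
relative speed `> w` with `u`-capped initial data has a backward cluster of more than `M`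
members, i.e. the datum is gathering) and `e^{lam(a+b)} ≤ ½(e^{2 lam a} + e^{2 lam b})`. -/
theorem eventually_of_stubs :
    ForecastWorldsGood → EnergyDomination → AnchoredCovering → TrueCapsExist →
      ForecastCapsExist → TightChainPressure → HotResidualPressure →
        InfluenceLocalityEventually := by
  intro hGood hDom hCov hTrue hFcst hChain hHot a θ u₀ ha hθ
  obtain ⟨σ₁, hσ₁, h1⟩ := hChain a θ u₀ ha hθ
  obtain ⟨σ₂, hσ₂, h2⟩ := hTrue a θ u₀ ha hθ
  obtain ⟨σ₃, hσ₃, h3⟩ := hFcst a θ u₀ ha hθ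
  obtain ⟨σ₄, hσ₄, h4⟩ := hHot a θ u₀ ha hθ
  refine ⟨min (min (min σ₁ σ₂) (min σ₃ σ₄)) (1 / 2), by positivity, ?_⟩
  intro σ hσ hσlt T lam δ hT hlam hδ
  have hm : min (min (min σ₁ σ₂) (min σ₃ σ₄)) (1 / 2) ≤ min (min σ₁ σ₂) (min σ₃ σ₄) :=
    min_le_left _ _
  have hσ₁' : σ < σ₁ :=
    lt_of_lt_of_le hσlt (hm.trans ((min_le_left _ _).trans (min_le_left _ _)))
  have hσ₂' : σ < σ₂ :=
    lt_of_lt_of_le hσlt (hm.trans ((min_le_left _ _).trans (min_le_right _ _)))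
  have hσ₃' : σ < σ₃ :=
    lt_of_lt_of_le hσlt (hm.trans ((min_le_right _ _).trans (min_le_left _ _)))
  have hσ₄' : σ < σ₄ :=
    lt_of_lt_of_le hσlt (hm.trans ((min_le_right _ _).trans (min_le_right _ _)))
  have hσhalf : σ ≤ 1 / 2 := (le_of_lt hσlt).trans (min_le_right _ _)
  have h2lam : 0 < 2 * lam := by positivity
  -- the affine chain constant, the genuine caps, the residual range
  obtain ⟨C, hC, hCK⟩ := h1 σ hσ hσ₁' T (2 * lam) δ hT h2lam hδ
  obtain ⟨u, huA, huT⟩ := h2 σ hσ hσ₂' T hT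
  obtain ⟨M, hMA, hMT⟩ := h3 σ hσ hσ₃' T hT
  obtain ⟨R₀, hR₀, hR⟩ := h4 σ hσ hσ₄' T (2 * lam) δ hT h2lam hδ u M huA hMA huT hMT
  obtain ⟨Ra, hRa, hua⟩ := huA
  obtain ⟨Rb, hRb, hMb⟩ := hMA
  -- the budget range R₁ and the range R (a plain variable with its four lower bounds)
  obtain ⟨α, hαdef⟩ : ∃ α : ℝ, α = (C * σ + 2 * T) * Real.sqrt θ := ⟨_, rfl⟩
  obtain ⟨β, hβdef⟩ : ∃ β : ℝ, β = (C * σ + 2 * T) * ‖u₀‖ + (C + 3) * σ := ⟨_, rfl⟩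
  have hα : 0 ≤ α := by rw [hαdef]; positivity
  have hβ : 0 ≤ β := by rw [hβdef]; positivity
  refine ⟨max (max R₀ ((α + β + 1) ^ 2)) (max Ra Rb),
    hR₀.trans_le ((le_max_left _ _).trans (le_max_left _ _)), fun R hRge => ?_⟩
  have hRR₀ : R₀ ≤ R := ((le_max_left _ _).trans (le_max_left _ _)).trans hRge
  have hRR₁ : (α + β + 1) ^ 2 ≤ R := ((le_max_right _ _).trans (le_max_left _ _)).trans hRge
  have hRRa : Ra ≤ R := ((le_max_left _ _).trans (le_max_right _ _)).trans hRge
  have hRRb : Rb ≤ R := ((le_max_right _ _).trans (le_max_right _ _)).trans hRge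
  have hRpos : 0 < R := hR₀.trans_le hRR₀
  have hR0 : 0 ≤ R := hRpos.le
  obtain ⟨hu0, hu2⟩ := hua R hRRa
  obtain ⟨hM1, hM2⟩ := hMb R hRRb
  -- caps at range R
  obtain ⟨w, hwdef⟩ : ∃ w : ℝ, w = u R * Real.sqrt (M R) := ⟨_, rfl⟩
  have hMR0 : (0 : ℝ) ≤ (M R : ℝ) := Nat.cast_nonneg _
  have hsqM1 : 1 ≤ Real.sqrt (M R) := by
    rw [← Real.sqrt_one]
    exact Real.sqrt_le_sqrt (by exact_mod_cast hM1)
  have huw : u R ≤ w := by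
    rw [hwdef]
    calc u R = u R * 1 := (mul_one _).symm
      _ ≤ u R * Real.sqrt (M R) := mul_le_mul_of_nonneg_left hsqM1 hu0.le
  have hw0 : 0 < w := hu0.trans_le huw
  have hwsq : w ^ 2 = u R ^ 2 * (M R : ℝ) := by
    rw [hwdef, mul_pow, Real.sq_sqrt hMR0]
  have hwle : w ≤ Real.sqrt θ * Real.sqrt R := by
    have h1 : w ^ 2 ≤ θ * R := by
      rw [hwsq]
      calc u R ^ 2 * (M R : ℝ) ≤ θ * Real.sqrt R * Real.sqrt R :=
            mul_le_mul hu2 hM2 hMR0 (by positivity)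
        _ = θ * R := by rw [mul_assoc, Real.mul_self_sqrt hR0]
    have h2 : Real.sqrt θ * Real.sqrt R = Real.sqrt (θ * R) := (Real.sqrt_mul hθ.le R).symm
    rw [h2, ← Real.sqrt_sq hw0.le]
    exact Real.sqrt_le_sqrt h1
  obtain ⟨wbar, hwbardef⟩ : ∃ wbar : ℝ, wbar = w + ‖u₀‖ := ⟨_, rfl⟩
  have hwbar0 : 0 < wbar := by rw [hwbardef]; positivity
  obtain ⟨K, hKC, hKle⟩ : ∃ K : ℕ, C * (1 + wbar) ≤ K ∧ (K : ℝ) ≤ C * (1 + wbar) + 1 :=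
    ⟨⌈C * (1 + wbar)⌉₊, Nat.le_ceil _, (Nat.ceil_lt_add_one (by positivity)).le⟩
  have hDpos : 0 < haloMargin u₀ σ T (u R) := by
    unfold haloMargin
    positivity
  -- the budget: (K + 2)σ + (u + w + 2‖u₀‖)T ≤ R
  have hbudget : ((K : ℝ) + 2) * σ + (u R + w + 2 * ‖u₀‖) * T ≤ R := by
    have hmain : α * Real.sqrt R + β ≤ R := sqrt_budget hα hβ hRR₁
    have hwbar : u R + w + 2 * ‖u₀‖ ≤ 2 * wbar := by rw [hwbardef]; linarith
    have e1 : ((K : ℝ) + 2) * σ ≤ (C * (1 + wbar) + 1 + 2) * σ :=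
      mul_le_mul_of_nonneg_right (by linarith) hσ.le
    have e2 : (u R + w + 2 * ‖u₀‖) * T ≤ (2 * wbar) * T :=
      mul_le_mul_of_nonneg_right hwbar hT.le
    have hwbarle : wbar ≤ Real.sqrt θ * Real.sqrt R + ‖u₀‖ := by rw [hwbardef]; linarith
    have hcoef : 0 ≤ C * σ + 2 * T := by positivity
    calc ((K : ℝ) + 2) * σ + (u R + w + 2 * ‖u₀‖) * T
        ≤ (C * (1 + wbar) + 1 + 2) * σ + (2 * wbar) * T := add_le_add e1 e2
      _ = (C * σ + 2 * T) * wbar + (C + 3) * σ := by ring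
      _ ≤ (C * σ + 2 * T) * (Real.sqrt θ * Real.sqrt R + ‖u₀‖) + (C + 3) * σ := by
          have := mul_le_mul_of_nonneg_left hwbarle hcoef
          linarith
      _ = α * Real.sqrt R + β := by rw [hαdef, hβdef]; ring
      _ ≤ R := hmain
  -- N₀
  obtain ⟨N₁, hN₁⟩ := hCK wbar hwbar0 K hKC
  obtain ⟨N₂, hN₂⟩ := hR R hRR₀
  refine ⟨max N₁ N₂, fun N hN Φ Ψ => ?_⟩
  unfold Bound
  have hchain := hN₁ N ((le_max_left _ _).trans hN) Φ
  have hhot := hN₂ N ((le_max_right _ _).trans hN) Φ Ψ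
  have hℓ : 0 < ell N := Real.rpow_pos_of_pos (by positivity) _
  -- (1) the a.e. pointwise covering  #bad ≤ #hotBad + #chainEnd
  have hae : ∀ᵐ z ∂(gibbs σ a θ u₀ N Φ), (badCount σ T R N Φ Ψ z : ℝ) ≤
      (hotBadCount σ T R N Φ Ψ u₀ (u R) (haloMargin u₀ σ T (u R)) (M R) z : ℝ) +
        (chainCount σ T N Φ wbar K z : ℝ) := by
    filter_upwards [hGood σ a θ u₀ N Φ Ψ R hσ hσhalf ha hθ,
      hCov σ a θ u₀ N Φ Ψ T R (u R) w (haloMargin u₀ σ T (u R)) K hσ hσhalf ha hθ hT.le hu0 huw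
        (by unfold haloMargin; exact le_rfl) hbudget] with z hzgood hzcov
    have key : ∀ i, IsBad σ T R N Φ Ψ z i →
        (IsBad σ T R N Φ Ψ z i ∧
          (IsHot σ T N Φ u₀ (u R) (R + haloMargin u₀ σ T (u R)) z i ∨
            IsGathering σ T R N Ψ (M R) z i)) ∨
          IsTightChain σ T N Φ wbar K z i := by
      intro i hbad
      by_cases hhoti : IsHot σ T N Φ u₀ (u R) (R + haloMargin u₀ σ T (u R)) z i
      · exact Or.inl ⟨hbad, Or.inl hhoti⟩
      by_cases hgath : IsGathering σ T R N Ψ (M R) z i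
      · exact Or.inl ⟨hbad, Or.inr hgath⟩
      suffices hnf : ¬ IsForecastHot σ T R N Ψ u₀ w z i by
        rw [hwbardef]
        exact Or.inr (hzcov i hbad hhoti hnf)
      -- no gathering + capped initial data ⇒ the forecast world of `i` is `w`-capped
      rintro ⟨m, q, hq0, hq1, hfast⟩
      have hγ : IsHardSphereTrajectory G3 (hsDiameter σ N) (rangeCluster G3 (R * ell N) z i).card
          (forecastWorld σ R N Ψ z i) :=
        (Ψ (rangeCluster G3 (R * ell N) z i).card).isTrajectory _ (hzgood.2 i)
      have ht : (0 : ℝ) ≤ T * ell N * q := by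
        have : (0 : ℝ) ≤ (q : ℝ) := by exact_mod_cast hq0
        positivity
      have hdom := hDom (rangeCluster G3 (R * ell N) z i).card (hsDiameter σ N)
        (forecastWorld σ R N Ψ z i) hγ u₀ m _ ht
      -- initial (= true) relative speeds of the cluster are ≤ u R (no hot particle at time 0)
      have hinit : ∀ a' : Fin (rangeCluster G3 (R * ell N) z i).card,
          ‖(forecastWorld σ R N Ψ z i 0 a').2 - u₀‖ ^ 2 ≤ u R ^ 2 := by
        intro a'
        have h0 : forecastWorld σ R N Ψ z i 0 =
            Config.restrictTo (rangeCluster G3 (R * ell N) z i) z :=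
          (Ψ (rangeCluster G3 (R * ell N) z i).card).flow_zero _ (hzgood.2 i)
        rw [h0, Config.restrictTo_apply]
        have hjS : (rangeCluster G3 (R * ell N) z i).orderEmbOfFin rfl a' ∈
            rangeCluster G3 (R * ell N) z i := Finset.orderEmbOfFin_mem _ rfl a'
        have hdist : Torus.euclidDist (z ((rangeCluster G3 (R * ell N) z i).orderEmbOfFin rfl a')).1
            (z i).1 < (R + haloMargin u₀ σ T (u R)) * ell N := by
          have hgap : R * ell N < (R + haloMargin u₀ σ T (u R)) * ell N := by
            have := mul_pos hDpos hℓ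
            linarith [add_mul R (haloMargin u₀ σ T (u R)) (ell N)]
          rcases mem_rangeCluster_torus.1 hjS with hji | hle
          · rw [hji, Torus.euclidDist_self]
            exact lt_trans (mul_pos hRpos hℓ) hgap
          · rw [Torus.euclidDist_comm] at hle
            exact lt_of_le_of_lt hle hgap
        have hslow : ‖(z ((rangeCluster G3 (R * ell N) z i).orderEmbOfFin rfl a')).2 - u₀‖ ≤ u R := by
          by_contra hcon
          push Not at hcon
          refine hhoti ⟨(rangeCluster G3 (R * ell N) z i).orderEmbOfFin rfl a', 0, le_rfl,
            zero_le_one, ?_, ?_⟩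
          · simpa [Φ.flow_zero z hzgood.1] using hcon
          · simpa [Φ.flow_zero z hzgood.1] using hdist
        exact pow_le_pow_left₀ (norm_nonneg _) hslow 2
      have hcard : ((insert m (backwardCluster G3 (hsDiameter σ N) (forecastWorld σ R N Ψ z i) m 0
          (T * ell N * q))).card : ℝ) ≤ (M R : ℝ) := by
        have : (insert m (backwardCluster G3 (hsDiameter σ N) (forecastWorld σ R N Ψ z i) m 0
            (T * ell N * q))).card ≤ M R := by
          by_contra hcon
          push Not at hcon
          exact hgath ⟨m, q, hq0, hq1, hcon⟩
        exact_mod_cast this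
      have hsq : ‖(forecastWorld σ R N Ψ z i (T * ell N * q) m).2 - u₀‖ ^ 2 ≤ w ^ 2 := by
        refine hdom.trans ?_
        calc ∑ a' ∈ insert m (backwardCluster G3 (hsDiameter σ N) (forecastWorld σ R N Ψ z i) m 0
                (T * ell N * q)), ‖(forecastWorld σ R N Ψ z i 0 a').2 - u₀‖ ^ 2
            ≤ ∑ _a' ∈ insert m (backwardCluster G3 (hsDiameter σ N) (forecastWorld σ R N Ψ z i) m 0
                (T * ell N * q)), u R ^ 2 := Finset.sum_le_sum fun a' _ => hinit a'
          _ = ((insert m (backwardCluster G3 (hsDiameter σ N) (forecastWorld σ R N Ψ z i) m 0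
                (T * ell N * q))).card : ℝ) * u R ^ 2 := by
              rw [Finset.sum_const, nsmul_eq_mul]
          _ ≤ (M R : ℝ) * u R ^ 2 := mul_le_mul_of_nonneg_right hcard (sq_nonneg _)
          _ = w ^ 2 := by rw [hwsq, mul_comm]
      have hle : ‖(forecastWorld σ R N Ψ z i (T * ell N * q) m).2 - u₀‖ ≤ w :=
        le_of_pow_le_pow_left₀ two_ne_zero hw0.le hsq
      exact (not_lt.2 hle) hfast
    exact_mod_cast badCount_le_of_cover key
  -- (2) integrate
  have hmeas := measurable_exp_chainCount σ T N Φ wbar K (2 * lam)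
  have h2 : (2⁻¹ : ℝ≥0∞) ≠ ∞ := ENNReal.inv_ne_top.2 two_ne_zero
  calc ∫⁻ z, ENNReal.ofReal (Real.exp (lam * (badCount σ T R N Φ Ψ z : ℝ))) ∂(gibbs σ a θ u₀ N Φ)
      ≤ ∫⁻ z, (ENNReal.ofReal (Real.exp (2 * lam *
            (hotBadCount σ T R N Φ Ψ u₀ (u R) (haloMargin u₀ σ T (u R)) (M R) z : ℝ))) * 2⁻¹ +
          ENNReal.ofReal (Real.exp (2 * lam * (chainCount σ T N Φ wbar K z : ℝ))) * 2⁻¹)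
            ∂(gibbs σ a θ u₀ N Φ) := by
        refine lintegral_mono_ae (hae.mono fun z hz => ?_)
        refine le_trans ?_ (ofReal_exp_mul_add_le lam _ _)
        exact ENNReal.ofReal_le_ofReal (Real.exp_le_exp.2 (mul_le_mul_of_nonneg_left hz hlam.le))
    _ = ∫⁻ z, ENNReal.ofReal (Real.exp (2 * lam *
            (hotBadCount σ T R N Φ Ψ u₀ (u R) (haloMargin u₀ σ T (u R)) (M R) z : ℝ))) * 2⁻¹ ∂(gibbs σ a θ u₀ N Φ) +
        ∫⁻ z, ENNReal.ofReal (Real.exp (2 * lam * (chainCount σ T N Φ wbar K z : ℝ))) * 2⁻¹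
            ∂(gibbs σ a θ u₀ N Φ) :=
        lintegral_add_right _ (hmeas.mul_const _)
    _ = (∫⁻ z, ENNReal.ofReal (Real.exp (2 * lam *
            (hotBadCount σ T R N Φ Ψ u₀ (u R) (haloMargin u₀ σ T (u R)) (M R) z : ℝ))) ∂(gibbs σ a θ u₀ N Φ)) * 2⁻¹ +
        (∫⁻ z, ENNReal.ofReal (Real.exp (2 * lam * (chainCount σ T N Φ wbar K z : ℝ)))
            ∂(gibbs σ a θ u₀ N Φ)) * 2⁻¹ := by
        rw [lintegral_mul_const' _ _ h2, lintegral_mul_const _ hmeas]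
    _ ≤ ENNReal.ofReal (Real.exp (δ * (N + 1))) * 2⁻¹ +
        ENNReal.ofReal (Real.exp (δ * (N + 1))) * 2⁻¹ := by
        gcongr
    _ = ENNReal.ofReal (Real.exp (δ * (N + 1))) := by
        rw [← mul_add, ENNReal.inv_two_add_inv_two, mul_one]

/-- **THE SKELETON.** The crux `AntiMazurCoboundaries.InfluenceLocality` BY NAME, from the seven
registered stubs (the only `sorry`s of this file) through `eventually_of_stubs`; the eventual
form gives the crux at `R = R₀`. When the stubs land this is the crux proof. -/
theorem InfluenceLocality_of :
    Summit.AtomisticToContinuum.HydrodynamicLimit.Theses.AntiMazurCoboundaries.InfluenceLocality := by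
  have h : InfluenceLocalityEventually :=
    eventually_of_stubs stub_forecastWorldsGood stub_energyDomination stub_anchoredCovering
      stub_trueCapsExist stub_forecastCapsExist stub_tightChainPressure stub_hotResidualPressure
  rw [influenceLocality_iff]
  intro a θ u₀ ha hθ
  obtain ⟨σ₀, hσ₀, hσ⟩ := h a θ u₀ ha hθ
  refine ⟨σ₀, hσ₀, fun σ hs hs' T lam δ hT hlam hδ => ?_⟩
  obtain ⟨R₀, hR₀, hR⟩ := hσ σ hs hs' T lam δ hT hlam hδ
  obtain ⟨N₀, hN⟩ := hR R₀ le_rfl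
  exact ⟨R₀, hR₀, N₀, hN⟩

/-! ## Honesty checks: the residual is not stronger than the (eventual) crux -/

/-- THE RESIDUAL IS NECESSARY: the eventual form of the crux implies `HotResidualPressure`
(for every pair of schedules, genuine or not: `#hotBad ≤ #bad` pointwise). So
`eventually_of_stubs` is a genuine reduction of the eventual crux to its hot sector, given
the six other stubs (and the eventual crux is what every consumer uses, Disproof §D). -/
theorem hotResidual_of_eventually (h : InfluenceLocalityEventually) : HotResidualPressure := by
  intro a θ u₀ ha hθ
  obtain ⟨σ₀, hσ₀, hσ⟩ := h a θ u₀ ha hθ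
  refine ⟨σ₀, hσ₀, fun σ hs hs' T lam δ hT hlam hδ u M _ _ _ _ => ?_⟩
  obtain ⟨R₀, hR₀, hR⟩ := hσ σ hs hs' T lam δ hT hlam hδ
  refine ⟨R₀, hR₀, fun R hRR => ?_⟩
  obtain ⟨N₀, hN⟩ := hR R hRR
  refine ⟨N₀, fun N hNN Φ Ψ => le_trans ?_ (hN N hNN Φ Ψ)⟩
  refine lintegral_mono fun z => ENNReal.ofReal_le_ofReal (Real.exp_le_exp.2 ?_)
  exact mul_le_mul_of_nonneg_left
    (by exact_mod_cast hotBadCount_le_badCount σ T R N Φ Ψ u₀ (u R) _ (M R) z) hlam.le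


end

end Summit.AtomisticToContinuum.HydrodynamicLimit.Theorems.TrueAnchoredInfection
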